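import Literature.Computability.Complexity.CHApproxBits
import HarnessLib

/-!
# Prime indices, blocks of primes, and their products modulo short primes inside `CH`

Ninth toolkit file (theorems only) of the scaled-up `FOM + MAJ` calculus: the bookkeeping of the
auxiliary moduli in Hesse–Allender–Barrington's conversion from Chinese remainder representation
to binary (JCSS 65 (2002), proof of Thm. 4.1: "we create numbers `A₁, …, A_s`, each a product of
polynomially many distinct short odd primes … each `Aᵢ` can be taken to be `∏_{j=1}^{k} p_{ik+j}` …
The list of primes less than `n^{O(1)}` can be computed by an FOM circuit"), scaled up to `CH`:

* `primeIdxGraph_mem_CH`: the prime-index function `q ↦ #{primes < q}` (`Nat.count Nat.Prime`)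
  has a `CH` graph (a count);
* `inBlock_mem_CH`: the block predicate "`q < 2^{t|u|}` is a prime with index in `[lo, hi)` and
  `q ≠ e`" on words `⟨⟨u, ⟨lo, ⟨hi, e⟩⟩⟩, q⟩`;
* `blockProdModGraph_mem_CH` / `blockProdMod_eq`: the product of the primes of a block (with one
  prime `e` possibly removed) modulo a short prime `m` is a `CH`-graph function of
  `⟨⟨u, ⟨lo, ⟨hi, e⟩⟩⟩, m⟩` (an instance of `iterProdModGraph_mem_CH`), equal to
  `(∏_{q ∈ blockSet} q) mod m` for the finite set `blockSet` of those primes.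

## References

* W. Hesse, E. Allender, D. A. M. Barrington, JCSS 65 (2002), proof of Thm. 4.1.
* P. Bürgisser, ECCC TR06-113 (2006), Thm. 3.4.
-/

namespace Literature.Computability.Complexity

open _root_.Computability Polynomial PRelSigma TTClosure Brick PPSharpP ThresholdPP Plumb Finset

/-! ### The prime-index function -/

/-- `∑_{y<N} [y < p ∧ y prime] = #{primes < p}` for `p ≤ N`. [folklore] -/
theorem sum_ite_lt_prime_eq_count (p N : ℕ) (h : p ≤ N) :
    (∑ y ∈ range N, if y < p ∧ y.Prime then 1 else 0) = Nat.count Nat.Prime p := by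
  rw [Nat.count_eq_card_filter_range, Finset.card_eq_sum_ones, Finset.sum_filter]
  rw [← Finset.sum_range_add_sum_Ico _ h]
  have h0 : ∑ y ∈ Finset.Ico p N, (if y < p ∧ y.Prime then 1 else 0) = 0 :=
    Finset.sum_eq_zero fun y hy => by rw [if_neg (fun h' => absurd h'.1 (by have := (Finset.mem_Ico.1 hy).1; omega))]
  rw [h0, add_zero]
  refine Finset.sum_congr rfl fun y hy => ?_
  simp only [Finset.mem_range] at hy
  simp [hy]

/-- **The prime-index function has a `CH` graph**: `{⟨q, ν⟩ | #{primes < val q} = val ν} ∈ CH`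
(a witness count of the `CH` predicate "prime and below `val q`"). [cite: HesseAllenderBarrington2002, Theorem 4.1] -/
theorem primeIdxGraph_mem_CH : {z | Nat.count Nat.Prime (bitsToNat (fstP z)) = bitsToNat (sndP z)} ∈ CH := by
  have hC : ({w | bitsToNat (sndP w) < bitsToNat (fstP w) ∧ (bitsToNat (sndP w)).Prime} : Language Bool) ∈ CH :=
    mem_CH_of_iff (inter_P_mem_CH gtVal_mem_P (preimage_mem_CH primeVal_mem_CH sndP_mem_FP)) _ fun w => by
      rw [memL_inf']; rfl
  have hone : {z | (fun _ : List Bool => (1 : ℕ)) (fstP z) = bitsToNat (sndP z)} ∈ CH :=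
    mem_CH_of_iff (P_subset_CH (preimage_mem_P (valEqConst_mem_P 1) sndP_mem_FP)) _ fun z => by
      change (1 : ℕ) = bitsToNat (sndP z) ↔ bitsToNat (sndP z) = 1
      exact eq_comm
  have hzero : {z | (fun _ : List Bool => (0 : ℕ)) (fstP z) = bitsToNat (sndP z)} ∈ CH :=
    mem_CH_of_iff (P_subset_CH (preimage_mem_P valZero_mem_P sndP_mem_FP)) _ fun z => by
      change (0 : ℕ) = bitsToNat (sndP z) ↔ bitsToNat (sndP z) = 0
      exact eq_comm
  have hf := iteGraph_mem_CH' hC (f := fun _ => 1) (g := fun _ => 0) hone hzero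
  have hb : ∀ w, (if bitsToNat (sndP w) < bitsToNat (fstP w) ∧ (bitsToNat (sndP w)).Prime then 1 else 0) <
      2 ^ (1 : Polynomial ℕ).eval w.length := fun w => by
    rw [eval_one]; split_ifs <;> norm_num
  refine mem_CH_of_iff (sumGraph_mem_CH hf hb X) _ fun z => ?_
  change _ ↔ (∑ i ∈ range (2 ^ (X : Polynomial ℕ).eval (fstP z).length),
    (if bitsToNat (sndP (boolPair (fstP z) (encodeNat i))) < bitsToNat (fstP (boolPair (fstP z) (encodeNat i))) ∧
      (bitsToNat (sndP (boolPair (fstP z) (encodeNat i)))).Prime then 1 else 0)) = bitsToNat (sndP z)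
  simp only [fstP_boolPair, sndP_boolPair, bitsToNat_encodeNat, eval_X]
  rw [sum_ite_lt_prime_eq_count _ _ (bitsToNat_lt _).le]
  exact Iff.rfl

/-- The prime index is below the numeral's range: `#{primes < val w} < 2^{|w|}`. [folklore] -/
theorem primeIdx_lt_two_pow (w : List Bool) : Nat.count Nat.Prime (bitsToNat w) < 2 ^ (X : Polynomial ℕ).eval w.length :=
  (Nat.count_le Nat.Prime).trans_lt (val_lt_two_pow_eval_X w)

/-! ### Blocks of primes -/

section Blocks

variable (t : Polynomial ℕ)

/-- **The block predicate is in `CH`**: on words `w = ⟨b, q⟩`, `b = ⟨u, ⟨lo, ⟨hi, e⟩⟩⟩`, the predicate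
"`|q| ≤ t(|u|)`, `val q` is prime, `val lo ≤ #{primes < val q} < val hi`, and `val q ≠ val e`". [cite: HesseAllenderBarrington2002, Theorem 4.1] -/
theorem inBlock_mem_CH :
    ({w | (sndP w).length ≤ t.eval (fstP (fstP w)).length ∧ (bitsToNat (sndP w)).Prime ∧
        bitsToNat (fstP (sndP (fstP w))) ≤ Nat.count Nat.Prime (bitsToNat (sndP w)) ∧
        Nat.count Nat.Prime (bitsToNat (sndP w)) < bitsToNat (fstP (sndP (sndP (fstP w)))) ∧
        bitsToNat (sndP w) ≠ bitsToNat (sndP (sndP (sndP (fstP w))))} : Language Bool) ∈ CH := by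
  have hLen : (pairFn (fstP ∘ fstP) sndP ⁻¹' (LenLe t : Language Bool)) ∈ Classes.P :=
    preimage_mem_P (LenLe_mem_P t) (pairFn_mem_FP (comp_mem_FP fstP_mem_FP fstP_mem_FP) sndP_mem_FP)
  have hPr := preimage_mem_CH primeVal_mem_CH sndP_mem_FP
  have hLo := preimage_mem_CH (geGraph_mem_CH primeIdxGraph_mem_CH primeIdx_lt_two_pow)
    (pairFn_mem_FP sndP_mem_FP (comp_mem_FP fstP_mem_FP (comp_mem_FP sndP_mem_FP fstP_mem_FP)))
  have hHi := preimage_mem_CH (ltGraph_mem_CH primeIdxGraph_mem_CH primeIdx_lt_two_pow)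
    (pairFn_mem_FP sndP_mem_FP (comp_mem_FP fstP_mem_FP (comp_mem_FP sndP_mem_FP (comp_mem_FP sndP_mem_FP fstP_mem_FP))))
  have hNe := (compl_mem_P_iff).2 (preimage_mem_P eqVal_mem_P (pairFn_mem_FP sndP_mem_FP
      (comp_mem_FP sndP_mem_FP (comp_mem_FP sndP_mem_FP (comp_mem_FP sndP_mem_FP fstP_mem_FP)))))
  have hNe' : ({w | bitsToNat (sndP w) ≠ bitsToNat (sndP (sndP (sndP (fstP w))))} : Language Bool) ∈ Classes.P :=
    mem_P_of_iff hNe _ fun w => by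
      rw [memL_compl]
      change _ ↔ ¬ bitsToNat (fstP (pairFn sndP (sndP ∘ sndP ∘ sndP ∘ fstP) w)) = bitsToNat (sndP (pairFn sndP (sndP ∘ sndP ∘ sndP ∘ fstP) w))
      rw [pairFn_apply, fstP_boolPair, sndP_boolPair]; rfl
  refine mem_CH_of_iff (inter_P_mem_CH hLen (inter_mem_CH hPr (inter_mem_CH hLo (inter_mem_CH hHi (P_subset_CH hNe'))))) _
    fun w => ?_
  rw [memL_inf', memL_inf', memL_inf', memL_inf']
  change _ ↔ pairFn (fstP ∘ fstP) sndP w ∈ LenLe t ∧ (bitsToNat (sndP w)).Prime ∧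
    bitsToNat (sndP (pairFn sndP (fstP ∘ sndP ∘ fstP) w)) ≤ Nat.count Nat.Prime (bitsToNat (fstP (pairFn sndP (fstP ∘ sndP ∘ fstP) w))) ∧
    Nat.count Nat.Prime (bitsToNat (fstP (pairFn sndP (fstP ∘ sndP ∘ sndP ∘ fstP) w))) <
      bitsToNat (sndP (pairFn sndP (fstP ∘ sndP ∘ sndP ∘ fstP) w)) ∧
    bitsToNat (sndP w) ≠ bitsToNat (sndP (sndP (sndP (fstP w))))
  simp only [pairFn_apply, Function.comp_apply, fstP_boolPair, sndP_boolPair, boolPair_mem_LenLe]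
  exact Iff.rfl

/-- The block factor `a ⟨b, q⟩ = val q` if `q` is in the block, else `1`; its graph is in `CH`. [cite: HesseAllenderBarrington2002, Theorem 4.1] -/
theorem blockFactorGraph_mem_CH :
    {z | (if (sndP (fstP z)).length ≤ t.eval (fstP (fstP (fstP z))).length ∧ (bitsToNat (sndP (fstP z))).Prime ∧
          bitsToNat (fstP (sndP (fstP (fstP z)))) ≤ Nat.count Nat.Prime (bitsToNat (sndP (fstP z))) ∧
          Nat.count Nat.Prime (bitsToNat (sndP (fstP z))) < bitsToNat (fstP (sndP (sndP (fstP (fstP z))))) ∧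
          bitsToNat (sndP (fstP z)) ≠ bitsToNat (sndP (sndP (sndP (fstP (fstP z)))))
        then bitsToNat (sndP (fstP z)) else 1) = bitsToNat (sndP z)} ∈ CH := by
  have hval : {z | bitsToNat (sndP (fstP z)) = bitsToNat (sndP z)} ∈ CH :=
    mem_CH_of_iff (P_subset_CH (preimage_mem_P eqVal_mem_P (pairFn_mem_FP (comp_mem_FP sndP_mem_FP fstP_mem_FP) sndP_mem_FP))) _
      fun z => by
        change _ ↔ bitsToNat (fstP (pairFn (sndP ∘ fstP) sndP z)) = bitsToNat (sndP (pairFn (sndP ∘ fstP) sndP z))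
        rw [pairFn_apply, fstP_boolPair, sndP_boolPair]; rfl
  have hone : {z | (fun _ : List Bool => (1 : ℕ)) (fstP z) = bitsToNat (sndP z)} ∈ CH :=
    mem_CH_of_iff (P_subset_CH (preimage_mem_P (valEqConst_mem_P 1) sndP_mem_FP)) _ fun z => by
      change (1 : ℕ) = bitsToNat (sndP z) ↔ bitsToNat (sndP z) = 1
      exact eq_comm
  exact iteGraph_mem_CH' (inBlock_mem_CH t) (f := fun w => bitsToNat (sndP w)) (g := fun _ => 1) hval hone

/-- The block factor is below `2^{|w|}`. [folklore] -/
theorem blockFactor_lt_two_pow (w : List Bool) :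
    (if (sndP w).length ≤ t.eval (fstP (fstP w)).length ∧ (bitsToNat (sndP w)).Prime ∧
          bitsToNat (fstP (sndP (fstP w))) ≤ Nat.count Nat.Prime (bitsToNat (sndP w)) ∧
          Nat.count Nat.Prime (bitsToNat (sndP w)) < bitsToNat (fstP (sndP (sndP (fstP w)))) ∧
          bitsToNat (sndP w) ≠ bitsToNat (sndP (sndP (sndP (fstP w))))
        then bitsToNat (sndP w) else 1) < 2 ^ (X + 1 : Polynomial ℕ).eval w.length := by
  rw [eval_add, eval_X, eval_one]
  split_ifs
  · refine (bitsToNat_lt _).trans_le (Nat.pow_le_pow_right (by norm_num) ?_)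
    have h := length_fstF_sndF_le w
    change 2 * (fstP w).length + (sndP w).length ≤ _ at h
    omega
  · exact Nat.one_lt_two_pow (by omega)

/-- **Products over a block modulo a short prime are `CH`-definable**: on words `⟨b, m⟩`,
`b = ⟨u, ⟨lo, ⟨hi, e⟩⟩⟩`, the function `(∏_{q < 2^{t|b|}} a ⟨b, q⟩) mod val m` (for prime `val m`;
`0` otherwise), `a` the block factor. [cite: HesseAllenderBarrington2002, Theorem 4.1] -/
theorem blockProdModGraph_mem_CH :
    {z | (if (bitsToNat (sndP (fstP z))).Prime then
          (∏ q ∈ range (2 ^ t.eval (fstP (fstP z)).length),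
            (if (encodeNat q).length ≤ t.eval (fstP (fstP (fstP z))).length ∧ q.Prime ∧
                bitsToNat (fstP (sndP (fstP (fstP z)))) ≤ Nat.count Nat.Prime q ∧
                Nat.count Nat.Prime q < bitsToNat (fstP (sndP (sndP (fstP (fstP z))))) ∧
                q ≠ bitsToNat (sndP (sndP (sndP (fstP (fstP z)))))
              then q else 1)) % bitsToNat (sndP (fstP z))
        else 0) = bitsToNat (sndP z)} ∈ CH := by
  have h := iterProdModGraph_mem_CH t (blockFactorGraph_mem_CH t) (blockFactor_lt_two_pow t)
  refine mem_CH_of_iff h _ fun z => ?_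
  change _ ↔ (if (bitsToNat (sndP (fstP z))).Prime then
      (∏ q ∈ range (2 ^ t.eval (fstP (fstP z)).length),
        (if (sndP (boolPair (fstP (fstP z)) (encodeNat q))).length ≤ t.eval (fstP (fstP (boolPair (fstP (fstP z)) (encodeNat q)))).length ∧
            (bitsToNat (sndP (boolPair (fstP (fstP z)) (encodeNat q)))).Prime ∧
            bitsToNat (fstP (sndP (fstP (boolPair (fstP (fstP z)) (encodeNat q))))) ≤
              Nat.count Nat.Prime (bitsToNat (sndP (boolPair (fstP (fstP z)) (encodeNat q)))) ∧
            Nat.count Nat.Prime (bitsToNat (sndP (boolPair (fstP (fstP z)) (encodeNat q)))) <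
              bitsToNat (fstP (sndP (sndP (fstP (boolPair (fstP (fstP z)) (encodeNat q)))))) ∧
            bitsToNat (sndP (boolPair (fstP (fstP z)) (encodeNat q))) ≠
              bitsToNat (sndP (sndP (sndP (fstP (boolPair (fstP (fstP z)) (encodeNat q))))))
          then bitsToNat (sndP (boolPair (fstP (fstP z)) (encodeNat q))) else 1)) % bitsToNat (sndP (fstP z))
    else 0) = bitsToNat (sndP z)
  simp only [fstP_boolPair, sndP_boolPair, bitsToNat_encodeNat]
  exact Iff.rfl

/-- **The block product, identified**: the product of the block factors over `q < N'` is the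
product of the primes `q < 2^{t|u|}` with index in `[lo, hi)` and `q ≠ e`, as soon as
`2^{t|u|} ≤ N'`. [folklore] -/
theorem prod_blockFactor_eq (u : List Bool) (lo hi e N' : ℕ) (hN : 2 ^ t.eval u.length ≤ N') :
    (∏ q ∈ range N', (if (encodeNat q).length ≤ t.eval u.length ∧ q.Prime ∧ lo ≤ Nat.count Nat.Prime q ∧
        Nat.count Nat.Prime q < hi ∧ q ≠ e then q else 1)) =
      ∏ q ∈ (range (2 ^ t.eval u.length)).filter (fun q => q.Prime ∧ lo ≤ Nat.count Nat.Prime q ∧ Nat.count Nat.Prime q < hi ∧ q ≠ e), q := by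
  rw [Finset.prod_filter, ← Finset.prod_range_mul_prod_Ico _ hN]
  have h1 : ∏ q ∈ Finset.Ico (2 ^ t.eval u.length) N', (if (encodeNat q).length ≤ t.eval u.length ∧ q.Prime ∧ lo ≤ Nat.count Nat.Prime q ∧
      Nat.count Nat.Prime q < hi ∧ q ≠ e then q else 1) = 1 :=
    Finset.prod_eq_one fun q hq => by
      rw [if_neg]
      intro h'
      have := (Brick.length_encodeNat_le_iff q _).1 h'.1
      have := (Finset.mem_Ico.1 hq).1
      omega
  rw [h1, mul_one]
  refine Finset.prod_congr rfl fun q hq => ?_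
  simp only [Finset.mem_range] at hq
  simp only [Brick.length_encodeNat_le_iff, hq, true_and]

end Blocks

end Literature.Computability.Complexity
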